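import Mathlib
import Literature.Combinatorics.Optimization.CorrelationPolytopeGridMinor
import HarnessLib

/-!
# Boolean gates as faces of the correlation polytope of a graph

Aboulker–Fiorini–Huynh–Macchia–Seif prove their Theorem 6 (`xc(COR(G)) ≥ 2^{c' tw(G)}` on proper
minor-closed classes) by describing "a face of `COR(H)` which projects to the correlation polytope of the
complete bipartite graph `K_{h,h}`", the face being cut out by equations that "originate from valid
inequalities" and simulate Boolean constraints on the `0/1` points `(χ(X), χ(E(X)))` of `COR(H)`: e.g.
"`(¬i ∨ ¬j)` ... is equivalent to setting `x_{ij} = 0`", "`x_j + x_{j̄} − 2x_{jj̄} = 1` ... ensures that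
exactly one of `x_j` and `x_{j̄}` equals `1`", and "if `ij` is a vertical or horizontal edge of `H` ... we
set `x_i = x_j = x_{ij}` (note that `x_i ≤ x_{ij}` [sic, `x_{ij} ≤ x_i`] and `x_j ≤ x_{ij}` are both valid
inequalities)" [AboulkerEtAl2019, proof of Thm. 6, p. 6].

This file is the GATE TABLE of that technique for the tree's `corPolytopeGraph G = conv{corVec G b}`
(`CorrelationPolytopeGridMinor.lean`), for an ARBITRARY simple graph `G`: each row is a sparse linear
functional `cv` on `ℝ^{V × V}` with a bound `δ` such that `cv ⬝ᵥ corVec G b ≤ δ` for EVERY `b : V → Bool`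
(validity on all generators, hence on `COR(G)`), together with the exact Boolean meaning of tightness
`cv ⬝ᵥ corVec G b = δ`.  Besides the printed rows (ZERO `x_{uv} = 0`, NOT `x_u + x_v − 2x_{uv} = 1`, WIRE
`x_u = x_{uv} = x_v`) it contains the two-input gates NAND / NOR / AND / OR written on a `4`-CYCLE
`u – v – w – z – u` of `G` with inputs `u, v` and output the `2`-vertex wire `{w, z}` (`w ∼ v`, `z ∼ u`): a
triangle-free graph such as a grid has no triangle `u v o` on which the three products `x_{uv}, x_{uo},
x_{vo}` would all be coordinates, and the contracted `4`-cycle is exactly the printed minor step "done in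
place".  Each gate is ONE inequality valid on all `16` local patterns — the term `2x_{wz} − x_w − x_z`-type
"wire bracket" is what keeps it valid OFF the wire face `b w = b z` — and its tight points ON the wire face
are exactly the graph of the gate (`nand_tight_iff` etc.; the two WIRE rows of `{w, z}` are load-bearing:
each gate functional has one more zero off the wire face).  These rows are the alphabet in which the
grid face of `COR(G_{t,t})` projecting onto `COR(K_h)` is written (NAND suffices: XOR = 4 NAND, a planar
crossover = 3 XOR); the gadget there is NOT the printed Lichtenstein-derived one, the principle is.

* `fvec L` — the sparse functional `Σ_{(p,k) ∈ L} k·e_p` (its evaluation lemma is private plumbing);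
* `zeroRow`, `notRow`, `nandRow`, `norRow`, `andRow`, `orRow` (the lists) with `*_valid` (`≤ δ` for
  every `b`) and `*_tight_iff` (Boolean meaning of equality); the WIRE rows are those of
  `CorrelationPolytopeFaces.lean` (`wire_dotProduct_corVec_le`, not restated).

All statements proved; no named fact.

## References

* P. Aboulker, S. Fiorini, T. Huynh, M. Macchia, J. Seif, *Extension complexity of the correlation
  polytope*, Oper. Res. Lett. 47 (2019) 47–51 = arXiv:1806.00541, proof of Theorem 6 (p. 6, L1–19 of the
  held text: replacement rules, "the equations we add originate from valid inequalities", `x_{ij} = 0`,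
  `x_j + x_{j̄} − 2x_{jj̄} = 1`, `x_i = x_j = x_{ij}`).  Bib key `AboulkerEtAl2019`.
-/

noncomputable section

namespace Literature.Combinatorics.Optimization

open Matrix Finset

/-! ### Sparse functionals -/

/-- The sparse linear functional `Σ_{(p,k) ∈ L} k · e_p` on `ℝ^ι` given by a list of (coordinate,
coefficient) pairs (repetitions add up). [folklore] -/
def fvec {ι : Type} [DecidableEq ι] (L : List (ι × ℝ)) : ι → ℝ :=
  fun p => (L.map fun qk => if p = qk.1 then qk.2 else 0).sum

/-- The empty functional is `0` (plumbing). [folklore] -/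
@[simp] private theorem fvec_nil {ι : Type} [DecidableEq ι] : fvec ([] : List (ι × ℝ)) = 0 := by
  funext p; simp [fvec]

/-- Peeling one term off a sparse functional (plumbing). [folklore] -/
private theorem fvec_cons {ι : Type} [DecidableEq ι] (qk : ι × ℝ) (L : List (ι × ℝ)) :
    fvec (qk :: L) = Pi.single qk.1 qk.2 + fvec L := by
  funext p
  simp only [fvec, List.map_cons, List.sum_cons, Pi.add_apply]
  congr 1
  by_cases h : p = qk.1
  · subst h; simp
  · simp [h]

/-- `⟨Σ k·e_p, x⟩ = Σ k·x_p` (plumbing; the gate lemmas below are the public interface). [folklore] -/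
private theorem fvec_dotProduct {ι : Type} [Fintype ι] [DecidableEq ι] (L : List (ι × ℝ)) (x : ι → ℝ) :
    fvec L ⬝ᵥ x = (L.map fun qk => qk.2 * x qk.1).sum := by
  induction L with
  | nil => simp
  | cons qk L ih => rw [fvec_cons, add_dotProduct, single_dotProduct, ih, List.map_cons, List.sum_cons]

variable {V : Type} [Fintype V] [DecidableEq V] (G : SimpleGraph V) [DecidableRel G.Adj]

/-! ### The printed rows: ZERO, NOT (WIRE: see `CorrelationPolytopeFaces.lean`) -/

/-- ZERO row `−x_{uv} ≤ 0` (valid since `x_{uv} ≥ 0`; tight: `x_{uv} = 0`): simulates the clause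
`¬u ∨ ¬v`. [cite: AboulkerEtAl2019, proof of Thm. 6 (p. 6 L5: "(¬i ∨ ¬j) ... equivalent to setting x_{ij} = 0")] -/
def zeroRow (u v : V) : List ((V × V) × ℝ) := [((u, v), -1)]

/-- Validity of the ZERO row. [cite: AboulkerEtAl2019, proof of Thm. 6 (p. 6 L3–5)] -/
theorem zeroRow_valid {u v : V} (h : G.Adj u v) (b : V → Bool) :
    fvec (zeroRow u v) ⬝ᵥ corVec G b ≤ 0 := by
  rw [fvec_dotProduct]; simp only [zeroRow, List.map_cons, List.map_nil, List.sum_cons, List.sum_nil,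
    corVec_apply_adj G b h]
  cases b u <;> cases b v <;> norm_num

/-- Tightness of the ZERO row: `¬(b u ∧ b v)`. [cite: AboulkerEtAl2019, proof of Thm. 6 (p. 6 L5)] -/
theorem zeroRow_tight_iff {u v : V} (h : G.Adj u v) (b : V → Bool) :
    fvec (zeroRow u v) ⬝ᵥ corVec G b = 0 ↔ (b u && b v) = false := by
  rw [fvec_dotProduct]; simp only [zeroRow, List.map_cons, List.map_nil, List.sum_cons, List.sum_nil,
    corVec_apply_adj G b h]
  cases b u <;> cases b v <;> norm_num

/-- NOT row `x_u + x_v − 2x_{uv} ≤ 1` (tight: exactly one of `u, v`): the printed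
`x_j + x_{j̄} − 2x_{jj̄} = 1`. [cite: AboulkerEtAl2019, proof of Thm. 6 (p. 6 L8–9)] -/
def notRow (u v : V) : List ((V × V) × ℝ) := [((u, u), 1), ((v, v), 1), ((u, v), -2)]

/-- Validity of the NOT row (`b_u + b_v − 2 b_u b_v = b_u ⊕ b_v ≤ 1`). [cite: AboulkerEtAl2019, proof of Thm. 6 (p. 6 L8–9)] -/
theorem notRow_valid {u v : V} (h : G.Adj u v) (b : V → Bool) :
    fvec (notRow u v) ⬝ᵥ corVec G b ≤ 1 := by
  rw [fvec_dotProduct]; simp only [notRow, List.map_cons, List.map_nil, List.sum_cons, List.sum_nil,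
    corVec_apply_diag, corVec_apply_adj G b h]
  cases b u <;> cases b v <;> norm_num

/-- Tightness of the NOT row: `b v = ¬ b u`. [cite: AboulkerEtAl2019, proof of Thm. 6 (p. 6 L8–9: "exactly one of x_j and x_{j̄} equals 1")] -/
theorem notRow_tight_iff {u v : V} (h : G.Adj u v) (b : V → Bool) :
    fvec (notRow u v) ⬝ᵥ corVec G b = 1 ↔ b v = !b u := by
  rw [fvec_dotProduct]; simp only [notRow, List.map_cons, List.map_nil, List.sum_cons, List.sum_nil,
    corVec_apply_diag, corVec_apply_adj G b h]
  cases b u <;> cases b v <;> norm_num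

/-! WIRE rows (`x_{uv} − x_u ≤ 0`, tight iff `b u → b v`) are NOT restated here: they are
`Literature.Combinatorics.Optimization.wire_dotProduct_corVec_le` / `wire_dotProduct_corVec_eq_zero_iff`
(`Pi.single (u, v) 1 - Pi.single (u, u) 1`, `CorrelationPolytopeFaces.lean`), used twice (for `(u,v)` and for
`(v,u)`) to get `b u = b v` (`corVec_wire_iff`). -/

/-! ### Two-input gates on a `4`-cycle `u – v – w – z – u` (inputs `u, v`; output wire `{w, z}`) -/

section Gates

variable {u v w z : V}

/-- NAND row: `2x_u + 2x_v + x_w − x_{uv} − 2x_{vw} − 2x_{uz} + 2x_{wz} ≤ 3`, i.e. the valid inequality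
`3 − 2x_u − 2x_v − x_w + x_{uv} + 2x_{vw} + 2x_{uz} − 2x_{wz} ≥ 0` whose tight points on the wire face
`x_w = x_{wz} = x_z` are exactly `z = ¬(u ∧ v)`. [cite: AboulkerEtAl2019, proof of Thm. 6 (p. 6 L3 «the equations we add originate from valid inequalities») — PRINCIPLE only: the functional is a construction of this file, not printed] -/
def nandRow (u v w z : V) : List ((V × V) × ℝ) :=
  [((u, u), 2), ((v, v), 2), ((w, w), 1), ((u, v), -1), ((v, w), -2), ((u, z), -2), ((w, z), 2)]

/-- Validity of the NAND row on ALL generators (all `16` patterns of `b u, b v, b w, b z`).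
[cite: AboulkerEtAl2019, proof of Thm. 6 (p. 6 L3) — principle only; construction of this file] -/
theorem nandRow_valid (huv : G.Adj u v) (hvw : G.Adj v w) (hwz : G.Adj w z) (hzu : G.Adj z u)
    (b : V → Bool) : fvec (nandRow u v w z) ⬝ᵥ corVec G b ≤ 3 := by
  rw [fvec_dotProduct]
  simp only [nandRow, List.map_cons, List.map_nil, List.sum_cons, List.sum_nil, corVec_apply_diag,
    corVec_apply_adj G b huv, corVec_apply_adj G b hvw, corVec_apply_adj G b hwz,
    corVec_apply_adj G b hzu.symm]
  cases b u <;> cases b v <;> cases b w <;> cases b z <;> norm_num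

/-- Tightness of the NAND row ON THE WIRE FACE `b w = b z`: the output is `¬(b u ∧ b v)`.
[cite: AboulkerEtAl2019, proof of Thm. 6 (p. 6 L3–13) — principle only; the gate is this file's construction] -/
theorem nandRow_tight_iff (huv : G.Adj u v) (hvw : G.Adj v w) (hwz : G.Adj w z) (hzu : G.Adj z u)
    (b : V → Bool) :
    (fvec (nandRow u v w z) ⬝ᵥ corVec G b = 3 ∧ b w = b z) ↔ (b w = b z ∧ b z = !(b u && b v)) := by
  rw [fvec_dotProduct]
  simp only [nandRow, List.map_cons, List.map_nil, List.sum_cons, List.sum_nil, corVec_apply_diag,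
    corVec_apply_adj G b huv, corVec_apply_adj G b hvw, corVec_apply_adj G b hwz,
    corVec_apply_adj G b hzu.symm]
  cases b u <;> cases b v <;> cases b w <;> cases b z <;> norm_num

/-- NOR row: `x_u + x_v − x_z − x_{uv} − 2x_{vw} − 2x_{uz} + 2x_{wz} ≤ 1` (valid; tight on the wire face iff
`z = ¬(u ∨ v)`). [cite: AboulkerEtAl2019, proof of Thm. 6 (p. 6 L3) — principle only; the functional is this file's construction] -/
def norRow (u v w z : V) : List ((V × V) × ℝ) :=
  [((u, u), 1), ((v, v), 1), ((z, z), -1), ((u, v), -1), ((v, w), -2), ((u, z), -2), ((w, z), 2)]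

/-- Validity of the NOR row. [cite: AboulkerEtAl2019, proof of Thm. 6 (p. 6 L3) — principle only; construction of this file] -/
theorem norRow_valid (huv : G.Adj u v) (hvw : G.Adj v w) (hwz : G.Adj w z) (hzu : G.Adj z u)
    (b : V → Bool) : fvec (norRow u v w z) ⬝ᵥ corVec G b ≤ 1 := by
  rw [fvec_dotProduct]
  simp only [norRow, List.map_cons, List.map_nil, List.sum_cons, List.sum_nil, corVec_apply_diag,
    corVec_apply_adj G b huv, corVec_apply_adj G b hvw, corVec_apply_adj G b hwz,
    corVec_apply_adj G b hzu.symm]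
  cases b u <;> cases b v <;> cases b w <;> cases b z <;> norm_num

/-- Tightness of the NOR row on the wire face: output `¬(b u ∨ b v)`. [cite: AboulkerEtAl2019, proof of Thm. 6 (p. 6 L3) — principle only; construction of this file] -/
theorem norRow_tight_iff (huv : G.Adj u v) (hvw : G.Adj v w) (hwz : G.Adj w z) (hzu : G.Adj z u)
    (b : V → Bool) :
    (fvec (norRow u v w z) ⬝ᵥ corVec G b = 1 ∧ b w = b z) ↔ (b w = b z ∧ b z = !(b u || b v)) := by
  rw [fvec_dotProduct]
  simp only [norRow, List.map_cons, List.map_nil, List.sum_cons, List.sum_nil, corVec_apply_diag,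
    corVec_apply_adj G b huv, corVec_apply_adj G b hvw, corVec_apply_adj G b hwz,
    corVec_apply_adj G b hzu.symm]
  cases b u <;> cases b v <;> cases b w <;> cases b z <;> norm_num

/-- AND row: `−2x_w − 3x_z − x_{uv} + 2x_{vw} + 2x_{uz} + 2x_{wz} ≤ 0` (valid; tight on the wire face iff
`z = u ∧ v`). [cite: AboulkerEtAl2019, proof of Thm. 6 (p. 6 L3) — principle only; the functional is this file's construction] -/
def andRow (u v w z : V) : List ((V × V) × ℝ) :=
  [((w, w), -2), ((z, z), -3), ((u, v), -1), ((v, w), 2), ((u, z), 2), ((w, z), 2)]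

/-- Validity of the AND row. [cite: AboulkerEtAl2019, proof of Thm. 6 (p. 6 L3) — principle only; construction of this file] -/
theorem andRow_valid (huv : G.Adj u v) (hvw : G.Adj v w) (hwz : G.Adj w z) (hzu : G.Adj z u)
    (b : V → Bool) : fvec (andRow u v w z) ⬝ᵥ corVec G b ≤ 0 := by
  rw [fvec_dotProduct]
  simp only [andRow, List.map_cons, List.map_nil, List.sum_cons, List.sum_nil, corVec_apply_diag,
    corVec_apply_adj G b huv, corVec_apply_adj G b hvw, corVec_apply_adj G b hwz,
    corVec_apply_adj G b hzu.symm]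
  cases b u <;> cases b v <;> cases b w <;> cases b z <;> norm_num

/-- Tightness of the AND row on the wire face: output `b u ∧ b v`. [cite: AboulkerEtAl2019, proof of Thm. 6 (p. 6 L3) — principle only; construction of this file] -/
theorem andRow_tight_iff (huv : G.Adj u v) (hvw : G.Adj v w) (hwz : G.Adj w z) (hzu : G.Adj z u)
    (b : V → Bool) :
    (fvec (andRow u v w z) ⬝ᵥ corVec G b = 0 ∧ b w = b z) ↔ (b w = b z ∧ b z = (b u && b v)) := by
  rw [fvec_dotProduct]
  simp only [andRow, List.map_cons, List.map_nil, List.sum_cons, List.sum_nil, corVec_apply_diag,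
    corVec_apply_adj G b huv, corVec_apply_adj G b hvw, corVec_apply_adj G b hwz,
    corVec_apply_adj G b hzu.symm]
  cases b u <;> cases b v <;> cases b w <;> cases b z <;> norm_num

/-- OR row: `−x_u − x_v − x_w − 2x_z − x_{uv} + 2x_{vw} + 2x_{uz} + 2x_{wz} ≤ 0` (valid; tight on the wire
face iff `z = u ∨ v`). [cite: AboulkerEtAl2019, proof of Thm. 6 (p. 6 L3) — principle only; the functional is this file's construction] -/
def orRow (u v w z : V) : List ((V × V) × ℝ) :=
  [((u, u), -1), ((v, v), -1), ((w, w), -1), ((z, z), -2), ((u, v), -1), ((v, w), 2), ((u, z), 2),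
    ((w, z), 2)]

/-- Validity of the OR row. [cite: AboulkerEtAl2019, proof of Thm. 6 (p. 6 L3) — principle only; construction of this file] -/
theorem orRow_valid (huv : G.Adj u v) (hvw : G.Adj v w) (hwz : G.Adj w z) (hzu : G.Adj z u)
    (b : V → Bool) : fvec (orRow u v w z) ⬝ᵥ corVec G b ≤ 0 := by
  rw [fvec_dotProduct]
  simp only [orRow, List.map_cons, List.map_nil, List.sum_cons, List.sum_nil, corVec_apply_diag,
    corVec_apply_adj G b huv, corVec_apply_adj G b hvw, corVec_apply_adj G b hwz,
    corVec_apply_adj G b hzu.symm]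
  cases b u <;> cases b v <;> cases b w <;> cases b z <;> norm_num

/-- Tightness of the OR row on the wire face: output `b u ∨ b v`. [cite: AboulkerEtAl2019, proof of Thm. 6 (p. 6 L3) — principle only; construction of this file] -/
theorem orRow_tight_iff (huv : G.Adj u v) (hvw : G.Adj v w) (hwz : G.Adj w z) (hzu : G.Adj z u)
    (b : V → Bool) :
    (fvec (orRow u v w z) ⬝ᵥ corVec G b = 0 ∧ b w = b z) ↔ (b w = b z ∧ b z = (b u || b v)) := by
  rw [fvec_dotProduct]
  simp only [orRow, List.map_cons, List.map_nil, List.sum_cons, List.sum_nil, corVec_apply_diag,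
    corVec_apply_adj G b huv, corVec_apply_adj G b hvw, corVec_apply_adj G b hwz,
    corVec_apply_adj G b hzu.symm]
  cases b u <;> cases b v <;> cases b w <;> cases b z <;> norm_num

end Gates

end Literature.Combinatorics.Optimization

end
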